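import Mathlib
import Literature.Barriers.ValiantsHypothesis.AlgebraicNaturalProofs
import Literature.Computability.AlgebraicComplexity.ApolarityAction
import Summits.ValiantsHypothesis.ValiantsHypothesis.Theorems.BarrierLeverSuccinctHittingSetsForVPLowDegree
import Summits.ValiantsHypothesis.ValiantsHypothesis.Theorems.BarrierLeverSuccinctHittingSetsForVPLowSupport
import Summits.ValiantsHypothesis.ValiantsHypothesis.Theorems.BarrierLeverSuccinctHittingSetsForVPSparse
import Summits.ValiantsHypothesis.ValiantsHypothesis.Theorems.BarrierLeverSuccinctHittingSetsForVPLowPartials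
import Summits.ValiantsHypothesis.ValiantsHypothesis.Theorems.BarrierLeverSuccinctHittingSetsForVPStubFewLinearForms
import HarnessLib

/-!
# Crux `BarrierLever.SuccinctHittingSetsForVP` (stmt-ValiantsHypothesis-14610), line `registered` —
THE PROFILE OF A NATURAL PROOF AGAINST `VP` (registered stub `stub_counterexampleProfile`)

**What is proved (unconditional; structure of the open heart, it does NOT close the item).**
In FSV's framework over `ℂ` (tree regime `d = n`, coefficient variables indexed by
`degLEMonomials n`, simple class `SmallCircuits ℂ n b = {f : deg f ≤ n, L(f) ≤ n^b}`), this file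
assembles in ONE statement the five landed NECESSARY CONDITIONS on an algebraically natural proof
`D` against `SmallCircuits ℂ n b` (FSV Def. 1, for ANY distinguisher class `𝒟`), `n ≥ 4`, `b ≥ 4`:

* degree: `n^(b-2) < deg D` (`IsNaturalProof.pow_lt_totalDegree`, `…LowDegree.lean`);
* monomial width: every monomial of `D` involves `> n^(b-2)` coefficient variables
  (`card_support_gt_of_vanishes`, `…LowSupport.lean`);
* density: `D` has `> 2^(n^(b-3))` monomials (`two_pow_lt_card_support_of_isNaturalProof`,
  `…Sparse.lean`);
* partials: any finite-dimensional space containing all `g ⌟ D` (`apolarAction g D`) has dimension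
  `> 2^(n^(b-2))` (`two_pow_lt_finrank_of_isNaturalProof`, `…LowPartials.lean`);
* essential variables: if `D = G(ℓ_1, …, ℓ_t)` with affine forms `ℓ_j`, then `n^b < t(2n+2)`
  (contrapositive of `stub_fewLinearForms`, `…StubFewLinearForms.lean`).

Axioms: `propext`, `Classical.choice`, `Quot.sound`. References: [ForbesShpilkaVolk2018] Def. 1,
Def. 3, Question 6, Thm. 9.
-/

-- layout Summits/ValiantsHypothesis/ValiantsHypothesis forces the duplicated namespace component
set_option linter.dupNamespace false

namespace Summit.ValiantsHypothesis.ValiantsHypothesis.Theorems.BarrierLever.SuccinctHittingSetsForVP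

open Literature.Barriers.ValiantsHypothesis Literature.Computability.AlgebraicComplexity MvPolynomial

/-- **Registered stub `stub_counterexampleProfile`** (crux stmt-ValiantsHypothesis-14610, line
`registered`): the profile of an algebraically natural proof `D` against `SmallCircuits ℂ n b`
(`n ≥ 4`, `b ≥ 4`, any distinguisher class `𝒟`) — `deg D > n^(b-2)`; every monomial of `D` has
`> n^(b-2)` variables; `D` has `> 2^(n^(b-3))` monomials; the partial derivatives of `D` span
`> 2^(n^(b-2))` dimensions; and `D` is not a polynomial in `t` affine forms unless
`n^b < t(2n+2)`. [cite: ForbesShpilkaVolk2018, Def. 1 and Question 6] -/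
theorem stub_counterexampleProfile :
    ∀ n b : ℕ, 4 ≤ n → 4 ≤ b →
      ∀ (𝒟 : Set (MvPolynomial (degLEMonomials n) ℂ)) (D : MvPolynomial (degLEMonomials n) ℂ),
        IsNaturalProof (degLEMonomials n) (SmallCircuits ℂ n b) 𝒟 D →
          n ^ (b - 2) < D.totalDegree ∧
          (∀ m ∈ D.support, n ^ (b - 2) < m.support.card) ∧
          2 ^ (n ^ (b - 3)) < D.support.card ∧
          (∀ V : Submodule ℂ (MvPolynomial (degLEMonomials n) ℂ), FiniteDimensional ℂ V →
            (∀ g, apolarAction g D ∈ V) → 2 ^ (n ^ (b - 2)) < Module.finrank ℂ V) ∧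
          (∀ (t : ℕ) (ℓ : Fin t → MvPolynomial (degLEMonomials n) ℂ) (G : MvPolynomial (Fin t) ℂ),
            (∀ j, (ℓ j).totalDegree ≤ 1) → D = MvPolynomial.aeval ℓ G → n ^ b < t * (2 * n + 2)) := by
  intro n b hn hb 𝒟 D hD
  have hn3 : 3 ≤ n := by omega
  have hb2 : 2 ≤ b := by omega
  refine ⟨IsNaturalProof.pow_lt_totalDegree hn3 hb2 hD,
    fun m hm => card_support_gt_of_vanishes hn3 hb2 hD.2.2 hm,
    two_pow_lt_card_support_of_isNaturalProof hn hb hD,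
    fun V hVfd hVmem => two_pow_lt_finrank_of_isNaturalProof hn3 hb2 hD hVfd hVmem,
    fun t ℓ G hℓ hDeq => ?_⟩
  -- essential variables: contrapositive of `stub_fewLinearForms`
  by_contra hle
  push Not at hle
  obtain ⟨f, hf, hne⟩ := stub_fewLinearForms n t b hle D ⟨ℓ, G, hℓ, hDeq⟩ hD.2.1
  exact hne (hD.2.2 f hf)

end Summit.ValiantsHypothesis.ValiantsHypothesis.Theorems.BarrierLever.SuccinctHittingSetsForVP
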